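/-
Origin: expansion seat `prover-pub-hodgecm-own-htheta-g2-0`, handover #H21 2026-08-21T13:12:24Z md5 e2c932255550 (186 l.; NEW additive MODEL leaf — TRANSPOSITION item (vi) TEMPLATE: degree-guard heads with `6 ≤ finrank ℚ c.K` in place of `= 6`: `finrank_le_finrank_of_goodCtx` :47 (GoodCtx.forced gives j : c.K →+* L ⇒ [c.K:ℚ] ≤ [L:ℚ]), `four_le_finrank_of_goodCtx_ge` :52, `six_le_finrank_of_goodCtx_ge` :56, `isAnisotropic_of_goodCtx_ge` :61, `isAnisotropic_of_four_le` :67, `six_le_of_finrank_eq_six` :72 (the sextic case is an instance), `two_lt_finrank_of_goodCtx_ge` :86 (ball regime), `translOf_of_two_lt` :105 + `translOf_ge` :145 (twin of `translOf` `Model/TranslDischarge.lean`:134 with the guard weakened); author htheta-x1 under own-htheta; 9 theorems, 0 defs, 0 `def … : Prop`, nothing cited; imports installed modules only. CERT rc 0 ∕ 9 ∕ 9 trio as in the header; NAMES for audit: HodgeCM.Model.four_le_finrank_of_goodCtx_ge · HodgeCM.Model.isAnisotropic_of_goodCtx_ge · HodgeCM.Model.two_lt_finrank_of_goodCtx_ge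 · HodgeCM.Model.translOf_ge) (`HOME/pub-hodgecm-own-htheta/stage78/HodgeCM/Model/ThetaSpaceInputPinGe.lean`, md5 e2c932255550, 186 lines);
landed by the p-seat packager p gen 32 (p-g32) in gate run 77 as `HodgeCM/Model/ThetaSpaceInputPinGe.lean` (verbatim).
-/
/-
Copyright (c) 2026 the pub-hodgecm formalisation cell (harness21).  New file, not vendored.
Origin: seat `prover-pub-hodgecm-htheta-x1-0` (unit pub-hodgecm-htheta-x1, extra prover x1 UNDER own-htheta), 2026-08-21 — assignment own-htheta g2
STATUS 13:09:09Z «x1: TEMPLATE `_ge` TWINS» for TRANSPOSITION item (vi) (ITEM6-SPLIT.md (vi-2)∕(vi-4), coordinator ruling 13:01:49Z): the THREE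
degree consequences of E's sextic guard and the translation binder, re-stated with `= 6` replaced by the WEAKER guards a face meets.  Target in PKG:
`HodgeCM/Model/ThetaSpaceInputPinGe.lean` (NEW additive leaf; imports `Model/ThetaSpaceInputPin` + `Model/BallInstance` + `Model/TranslDischarge`, all
installed; nothing imports it yet — the (vi-2)∕(vi-4) `_ge` D-head twins of item6-p1∕p2 will).  KERNEL ONLY: theorems, no proof holes, nothing cited,
no hypothesis kind of E; nothing here is a claim of the manuscripts under adjudication.

WHAT IT IS — the `_ge` TEMPLATE for the twin chain.  E's theta-side D heads consume the sextic conjunct `hK : Module.finrank ℚ c.K = 6` ONLY through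
`two_lt_finrank_of_goodCtx` (`Model/BallInstance.lean`:119), `four_le_finrank_of_goodCtx` (`Model/ThetaSpaceInputPin.lean`:467) and
`isAnisotropic_of_goodCtx` (:475) — b01-idea-2 Δ3 ∕ ITEM6-SPLIT §(c) (vi-4): 17 sites — and through `Model.translOf` (`Model/TranslDischarge.lean`:115),
whose body needs `2 < [L:ℚ]` only.  Here: the same four statements with `hK : 6 ≤ Module.finrank ℚ c.K` (suffix `_ge`: what a face of a CM field of
degree ≥ 6 supplies at `c.K := F`), proofs = the originals' with `omega`-level edits; plus the WEAKEST forms keyed on `L` alone (`…_of_four_le`,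
`translOf_of_two_lt`) for heads that never look at `c.K`.  A `_ge` twin of a D head is then: same statement with `= 6 ↦ 6 ≤`, same proof with these
names substituted.
-/
import Summits.HodgeConjecture.HodgeCM.Model.ThetaSpaceInputPin_2
import Summits.HodgeConjecture.HodgeCM.Model.BallInstance
import Summits.HodgeConjecture.HodgeCM.Model.TranslDischarge

set_option autoImplicit false

noncomputable section

open MulAction NumberField
open scoped Matrix TensorProduct
open Literature.Geometry.ComplexHyperbolic.BallModel (U21 Ball Jac x₀)
open Literature.NumberTheory.Automorphic
open Literature.AlgebraicGeometry.HodgeTheory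
open Literature.AlgebraicGeometry.ShimuraVarieties
open Literature.NumberTheory.Automorphic.PicardCM
open Literature.NumberTheory.Transcendental (Arapura2012_Cor_15_4_6)
open HodgeCM.Model.ThetaSpace

namespace HodgeCM
namespace Model

/-! ## §1 Degree of `L` from a good context — guard `6 ≤ [c.K:ℚ]` (and the underlying monotonicity) -/

section Degree

variable {U : Universe} {T : U.ThetaModel} {L : CMField} {ι₁ : L →+* ℂ} {c : SeesawCtx L}

/-- **The one fact behind every degree consequence of a good context**: the types' field `c.K` EMBEDS in `L` (`GoodCtx.forced` gives `j : c.K →+* L`),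
so `[c.K:ℚ] ≤ [L:ℚ]`.  No numeral. [folklore] -/
theorem finrank_le_finrank_of_goodCtx (hc : T.GoodCtx ι₁ c) : Module.finrank ℚ c.K ≤ Module.finrank ℚ L := by
  obtain ⟨j, -, -⟩ := hc.forced
  exact LinearMap.finrank_le_finrank_of_injective (f := j.toRatAlgHom.toLinearMap) j.injective

/-- `_ge` twin of `four_le_finrank_of_goodCtx` (`Model/ThetaSpaceInputPin.lean`:467): guard `6 ≤ [c.K:ℚ]` instead of `= 6`. [folklore] -/
theorem four_le_finrank_of_goodCtx_ge (hc : T.GoodCtx ι₁ c) (hK : 6 ≤ Module.finrank ℚ c.K) : 4 ≤ Module.finrank ℚ L :=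
  le_trans (le_trans (by norm_num) hK) (finrank_le_finrank_of_goodCtx hc)

/-- The full strength of the `_ge` guard: `6 ≤ [L:ℚ]`. [folklore] -/
theorem six_le_finrank_of_goodCtx_ge (hc : T.GoodCtx ι₁ c) (hK : 6 ≤ Module.finrank ℚ c.K) : 6 ≤ Module.finrank ℚ L :=
  le_trans hK (finrank_le_finrank_of_goodCtx hc)

/-- `_ge` twin of `isAnisotropic_of_goodCtx` (`Model/ThetaSpaceInputPin.lean`:475): the regime — `V.Hm` is anisotropic — from the guard `6 ≤ [c.K:ℚ]`.
[folklore] -/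
theorem isAnisotropic_of_goodCtx_ge (V : HermSpace3 L ι₁) (hc : T.GoodCtx ι₁ c) (hK : 6 ≤ Module.finrank ℚ c.K) :
    IsAnisotropic L V.Hm :=
  V.isAnisotropic (four_le_finrank_of_goodCtx_ge hc hK)

/-- WEAKEST form, keyed on `L` alone (no context): `4 ≤ [L:ℚ]` gives the regime (`HermSpace3.isAnisotropic`, restated for the twin chain's uniform
naming). [folklore] -/
theorem isAnisotropic_of_four_le (V : HermSpace3 L ι₁) (h4 : 4 ≤ Module.finrank ℚ L) : IsAnisotropic L V.Hm :=
  V.isAnisotropic h4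

/-- The original sextic guard implies the `_ge` guard (so every `_ge` twin specialises back to E's head by `le_of_eq hK.symm`-style rewriting:
`(hK : finrank = 6) ↦ hK.ge`). [folklore] -/
theorem six_le_of_finrank_eq_six (hK : Module.finrank ℚ c.K = 6) : 6 ≤ Module.finrank ℚ c.K := hK.ge

end Degree

/-! ## §2 The model-universe forms (E's `two_lt_finrank_of_goodCtx`, `Model/BallInstance.lean`:119) -/

section ModelDegree

variable (hHD : exists_isReal_hodgeModel) (hI : hodgePQ_independent_of_hodgeModel)
  (h₁ : BallQuotientUniformised) (h₃ : CMAbelianVarietyRealised)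
variable {L : CMField} {ι₁ : L →+* ℂ}

/-- `_ge` twin of `two_lt_finrank_of_goodCtx` (`Model/BallInstance.lean`:119; same explicit universe rows, same binder order): on the model universe a
good context with `6 ≤ [c.K:ℚ]` forces the regime `2 < [L:ℚ]`. [folklore] -/
theorem two_lt_finrank_of_goodCtx_ge {T : (picardCMUniverse hHD hI h₁ h₃).ThetaModel} {c : SeesawCtx L}
    (hc : T.GoodCtx ι₁ c) (hK : 6 ≤ Module.finrank ℚ c.K) : 2 < Module.finrank ℚ L := by
  have h := finrank_le_finrank_of_goodCtx hc
  omega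

end ModelDegree

/-! ## §3 E's translation binder `transl` under the `_ge` guard and in its weakest form -/

section Transl

variable (hHD : exists_isReal_hodgeModel) (hI : hodgePQ_independent_of_hodgeModel)
  (h₁ : BallQuotientUniformised) (h₃ : CMAbelianVarietyRealised)
variable (S : ∀ {L : CMField} {ι₁ : L →+* ℂ} (V : HermSpace3 L ι₁) (c : SeesawCtx L), ThetaAdelicSide V c)
variable {L : CMField} {ι₁ : L →+* ℂ}

/-- **WEAKEST form of E's binder `transl`** (`Model.translOf`, `Model/TranslDischarge.lean`:115): the same conclusion over the ball data
`ballOf … V c hL` for ANY proof `hL : 2 < [L:ℚ]` of the regime — no good context, no degree of `c.K`.  Proof = `translOf`'s body verbatim with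
`two_lt_finrank_of_goodCtx … hc hK` replaced by `hL`. [folklore] -/
theorem translOf_of_two_lt (h : Bool)
    (emb : ∀ {L : CMField} {ι₁ : L →+* ℂ} {V : HermSpace3 L ι₁} (Γ : Level V),
      (picardCMUniverse hHD hI h₁ h₃).CohC ((picardCMUniverse hHD hI h₁ h₃).pms L ι₁ V Γ) 2 →ₗ[ℂ]
        (V.latticeModel printFact_unitaryCompact_holds).toQuotientModel.H)
    (wm : ∀ {L : CMField} {ι₁ : L →+* ℂ} (V : HermSpace3 L ι₁) (c : SeesawCtx L),
      WeilThetaModel (V.latticeModel printFact_unitaryCompact_holds).toQuotientModel.G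
        (V.latticeModel printFact_unitaryCompact_holds).toQuotientModel.Γ
        (c.D.latticeModelW printFact_unitaryCompact_holds).toQuotientModel.G
        (c.D.latticeModelW printFact_unitaryCompact_holds).toQuotientModel.Γ)
    (d12 d34 : ∀ {L : CMField}, SeesawCtx L → HodgeCM.Universe.SideData L)
    (hA : Arapura2012_Cor_15_4_6)
    (hStab : ∀ {L : CMField} {ι₁ : L →+* ℂ} (V : HermSpace3 L ι₁) (c : SeesawCtx L) (hV : IsAnisotropic L V.Hm),
      ∀ γ ∈ BallRational.ratImage L ι₁ V.Hm V.sylvesterFrame (sylvesterFrame_J V), ∀ (i : Fin 4) (Γ : Level V),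
      ∃ Γ' : Level V, ∀ F ∈ (thetaSpaceInputIn hHD hI h₁ h₃ (S V c) hV).Θ i Γ,
        ∃ F' ∈ (thetaSpaceInputIn hHD hI h₁ h₃ (S V c) hV).Θ i Γ', ∀ g : U21,
          F'.1 g = F.1 (γ * g))
    {L : CMField} {ι₁ : L →+* ℂ} (V : HermSpace3 L ι₁) (c : SeesawCtx L) (hL : 2 < Module.finrank ℚ L) :
    ∀ γ ∈ (ballOf hHD hI h₁ h₃ V c hL).Δ,
      ∀ (i : Fin 4) (Γ : Level V)
        (ω : (picardCMUniverse hHD hI h₁ h₃).CohC ((picardCMUniverse hHD hI h₁ h₃).pms L ι₁ V Γ) 1),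
      ω ∈ (thetaModelOf hHD hI h₁ h₃ h emb (coverOf hHD hI h₁ h₃ hA) wm
        (thetaOf _ (thetaClassInputOf _ (fun V c => thetaSpaceInputOf hHD hI h₁ h₃ S V c))) d12 d34).Theta
          V c i Γ →
      ∃ (Γ' : Level V)
        (ω' : (picardCMUniverse hHD hI h₁ h₃).CohC ((picardCMUniverse hHD hI h₁ h₃).pms L ι₁ V Γ') 1),
        ω' ∈ (thetaModelOf hHD hI h₁ h₃ h emb (coverOf hHD hI h₁ h₃ hA) wm
          (thetaOf _ (thetaClassInputOf _ (fun V c => thetaSpaceInputOf hHD hI h₁ h₃ S V c))) d12 d34).Theta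
            V c i Γ' ∧
        (ballOf hHD hI h₁ h₃ V c hL).ev Γ' ω' =
          fun x => (ballOf hHD hI h₁ h₃ V c hL).J γ x *ᵥ (ballOf hHD hI h₁ h₃ V c hL).ev Γ ω (γ • x) := by
  intro γ hγ i Γ ω hω
  have hV : IsAnisotropic L V.Hm := isAnisotropic_of_two_lt L ι₁ V Γ hL
  obtain ⟨Γ', hΘ⟩ := hStab V c hV γ hγ i Γ
  obtain ⟨ω', hω', heq⟩ :=
    transl_thetaSpaceInputOf_of_isAnisotropic hHD hI h₁ h₃ S V c hV γ i Γ Γ' hΘ hω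
  exact ⟨Γ', ω', hω', heq⟩

/-- **`_ge` twin of E's binder `transl`** (`Model.translOf` :115): statement VERBATIM with the guard `hK : 6 ≤ [c.K:ℚ]` in place of `= 6` and the
regime proof `two_lt_finrank_of_goodCtx_ge` in place of `two_lt_finrank_of_goodCtx` inside `ballOf`; proof = ONE application of `translOf_of_two_lt`.
[folklore] -/
theorem translOf_ge (h : Bool)
    (emb : ∀ {L : CMField} {ι₁ : L →+* ℂ} {V : HermSpace3 L ι₁} (Γ : Level V),
      (picardCMUniverse hHD hI h₁ h₃).CohC ((picardCMUniverse hHD hI h₁ h₃).pms L ι₁ V Γ) 2 →ₗ[ℂ]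
        (V.latticeModel printFact_unitaryCompact_holds).toQuotientModel.H)
    (wm : ∀ {L : CMField} {ι₁ : L →+* ℂ} (V : HermSpace3 L ι₁) (c : SeesawCtx L),
      WeilThetaModel (V.latticeModel printFact_unitaryCompact_holds).toQuotientModel.G
        (V.latticeModel printFact_unitaryCompact_holds).toQuotientModel.Γ
        (c.D.latticeModelW printFact_unitaryCompact_holds).toQuotientModel.G
        (c.D.latticeModelW printFact_unitaryCompact_holds).toQuotientModel.Γ)
    (d12 d34 : ∀ {L : CMField}, SeesawCtx L → HodgeCM.Universe.SideData L)
    (hA : Arapura2012_Cor_15_4_6)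
    (hStab : ∀ {L : CMField} {ι₁ : L →+* ℂ} (V : HermSpace3 L ι₁) (c : SeesawCtx L) (hV : IsAnisotropic L V.Hm),
      ∀ γ ∈ BallRational.ratImage L ι₁ V.Hm V.sylvesterFrame (sylvesterFrame_J V), ∀ (i : Fin 4) (Γ : Level V),
      ∃ Γ' : Level V, ∀ F ∈ (thetaSpaceInputIn hHD hI h₁ h₃ (S V c) hV).Θ i Γ,
        ∃ F' ∈ (thetaSpaceInputIn hHD hI h₁ h₃ (S V c) hV).Θ i Γ', ∀ g : U21,
          F'.1 g = F.1 (γ * g))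
    {L : CMField} {ι₁ : L →+* ℂ} (V : HermSpace3 L ι₁) (c : SeesawCtx L)
    (hc : (thetaModelOf hHD hI h₁ h₃ h emb (coverOf hHD hI h₁ h₃ hA) wm
      (thetaOf _ (thetaClassInputOf _ (fun V c => thetaSpaceInputOf hHD hI h₁ h₃ S V c))) d12 d34).GoodCtx ι₁ c)
    (hK : 6 ≤ Module.finrank ℚ c.K) :
    ∀ γ ∈ (ballOf hHD hI h₁ h₃ V c (two_lt_finrank_of_goodCtx_ge hHD hI h₁ h₃ hc hK)).Δ,
      ∀ (i : Fin 4) (Γ : Level V)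
        (ω : (picardCMUniverse hHD hI h₁ h₃).CohC ((picardCMUniverse hHD hI h₁ h₃).pms L ι₁ V Γ) 1),
      ω ∈ (thetaModelOf hHD hI h₁ h₃ h emb (coverOf hHD hI h₁ h₃ hA) wm
        (thetaOf _ (thetaClassInputOf _ (fun V c => thetaSpaceInputOf hHD hI h₁ h₃ S V c))) d12 d34).Theta
          V c i Γ →
      ∃ (Γ' : Level V)
        (ω' : (picardCMUniverse hHD hI h₁ h₃).CohC ((picardCMUniverse hHD hI h₁ h₃).pms L ι₁ V Γ') 1),
        ω' ∈ (thetaModelOf hHD hI h₁ h₃ h emb (coverOf hHD hI h₁ h₃ hA) wm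
          (thetaOf _ (thetaClassInputOf _ (fun V c => thetaSpaceInputOf hHD hI h₁ h₃ S V c))) d12 d34).Theta
            V c i Γ' ∧
        (ballOf hHD hI h₁ h₃ V c (two_lt_finrank_of_goodCtx_ge hHD hI h₁ h₃ hc hK)).ev Γ' ω' =
          fun x => (ballOf hHD hI h₁ h₃ V c (two_lt_finrank_of_goodCtx_ge hHD hI h₁ h₃ hc hK)).J γ x *ᵥ
            (ballOf hHD hI h₁ h₃ V c (two_lt_finrank_of_goodCtx_ge hHD hI h₁ h₃ hc hK)).ev Γ ω (γ • x) :=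
  translOf_of_two_lt hHD hI h₁ h₃ S h emb wm d12 d34 hA hStab V c (two_lt_finrank_of_goodCtx_ge hHD hI h₁ h₃ hc hK)

end Transl

end Model
end HodgeCM

end
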